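import Literature.AnabelianGeometry.SemiGraphs.PSCNodeExistenceTransferProofs
import Literature.AnabelianGeometry.SemiGraphs.PSCVertexQuotientPrimeProofs
import HarnessLib

/-!
# [CombGC] Theorem 1.6 (ii): the node-existence input `hn`, over the CORRECTED [IUTchI] Rmk. 1.2.3 (iv) split injection

Mochizuki, *A combinatorial version of the Grothendieck conjecture*, Tohoku Math. J. **59** (2007)
[CombGC], proof of Theorem 1.6 (ii), author's manuscript p. 14.  abc-iut-w4-d052's
`PSCNodeExistenceTransferProofs.lean` (row T16-L10b of `plan/L3/SUBDAG-CombGC-Thm16.md`) DERIVES the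
displayed node-existence input `hn : Nonempty G.graph.N ↔ Nonempty H.graph.N` of the cell's Rmk.-1.2.3-(v)
kernel from, among others, the FROZEN split injection `UnrVerticialSplitInjection` ([IUTchI]
Rmk. 1.2.3 (iv); FACT row F-1938, REFUTED as typed at one-vertex data, abc-iut finding F-L3t4g5-1) —
which it uses only through the two bodies (EX) "the vertex quotient `M^unr-vert ↠ M^unr[v] ⊗ F_l` is the
restriction of an elementary abelian quotient of `M^unr`" and "[nontrivial!]".

SUCCESSOR MIGRATION.  This proof-only file re-derives the same statements over the CORRECTED successor
`UnrVerticialSplitInjection'` (`PSCRamificationSplitInjection.lean`, abc-iut-L3-t4), via the corrected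
bodies of `PSCVertexQuotientPrimeProofs.lean`:

* `exists_level_edgeFil_ne_cuspFil_of_bodies` — d052's level construction with the two bodies as
  explicit hypotheses (proof verbatim): a noncuspidal STURDY `G` WITH A NODE has a `Π^unr`-level `U` at
  which `M^edge_{G_U} ≠ M^cusp_{G_U}` (`U = ⋂_v H_v` for the kernels `H_v` of the elementary abelian
  vertex quotients; `i(G_U) ≤ n(G_U)`; Rmk. 1.1.3 and Rmk. 1.3.1);
* `exists_level_edgeFil_ne_cuspFil'`, `nonempty_nodes_of_isGraphicallyFiltrationPreserving'`,
  `nonempty_nodes_iff_of_inputs'` — the three statements of the frozen file with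
  `UnrVerticialSplitInjection'` in place of `UnrVerticialSplitInjection`, valid for every datum
  (one-vertex data included).

Proof-only (0 defs); plain profinite group theory over the interface; a FACT row is an assumption label;
nothing here takes a side on [IUTchIII] Cor. 3.12. [cite: MochizukiCombGC2007, Thm 1.6(ii) p.14]
[cite: MochizukiCombGC2007, Rmk 1.3.1 p.10] [cite: Mochizuki2012, IUTchI Rmk 1.2.3(iv) p.42]
-/

noncomputable section

namespace Literature.AnabelianGeometry.SemiGraphs

namespace PSCDatum

open SemiGraphOfAnabelioids (IsProSigmaCompletion)

universe u

variable {P : Type u} [Group P] [TopologicalSpace P] [IsTopologicalGroup P]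

omit [TopologicalSpace P] [IsTopologicalGroup P] in
/-- A subgroup `V ⊇ [U, U]` is normal in `U` (as `V.subgroupOf U`). [folklore] -/
private theorem normal_subgroupOf_of_commutator_le'' {U V : Subgroup P} (h : ⁅U, U⁆ ≤ V) :
    (V.subgroupOf U).Normal := by
  refine ⟨fun n hn g => ?_⟩
  rw [Subgroup.mem_subgroupOf] at hn ⊢
  have hc : (g : P) * n * (g : P)⁻¹ * (n : P)⁻¹ ∈ V :=
    h (Subgroup.commutator_mem_commutator g.2 n.2)
  simpa using V.mul_mem hc hn

/-! ### A level of a nodal sturdy datum at which `M^edge ≠ M^cusp`, from the two bodies -/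

section Level

variable [CompactSpace P] [T2Space P] (G : PSCDatum P)

omit [T2Space P] in
/-- **A noncuspidal sturdy `G` WITH A NODE has a `Π^unr`-level at which `M^edge ≠ M^cusp` — from the two
[IUTchI] Rmk. 1.2.3 (iv) bodies as hypotheses**: (EX) for every vertex `v` an elementary abelian quotient of
`M^unr_G` (kernel `H_v`) restricting on `M^unr-vert_G` to the vertex quotient at `v`, and "[nontrivial!]"
`Ker_v ≠ M^unr-vert_G`.  Take `U = ⋂_v H_v`; then `i(G_U) ≤ n(G_U)`, so `M_{G_U}/M^vert_{G_U}` has rank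
`n(G_U) + 1 − i(G_U) ≥ 1` (Rmk. 1.1.3) and `M^edge_{G_U}/M^cusp_{G_U}` has the same positive rank
(Rmk. 1.3.1, sturdy).  (abc-iut-w4-d052's `exists_level_edgeFil_ne_cuspFil`, the bodies made
parameters.) [cite: MochizukiCombGC2007, Rmk 1.3.1 p.10] -/
theorem exists_level_edgeFil_ne_cuspFil_of_bodies {l : ℕ} (hS : G.Sigma = {l}) (hGs : G.IsSturdy)
    (hEX : ∀ v : G.graph.V, ∃ H' : Subgroup P, G.IsElemAbUnrQuotient l H' ∧ G.unrVertAb ⊔ H' = ⊤ ∧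
      G.unrVertAb ⊓ H' = G.vertexQuotientKer l v)
    (hNE : ∀ v : G.graph.V, G.vertexQuotientKer l v ≠ G.unrVertAb)
    (hgrph : G.AbelianizedGrphRank) (hdual : G.DualityRankEq) (hconn : G.VertCountLeNodeCountSucc)
    (hN : Nonempty G.graph.N) :
    ∃ U : Subgroup P, IsOpen (U : Set P) ∧ G.edgeFil U ≠ G.cuspFil U := by
  have hlS : l ∈ G.Sigma := by rw [hS]; exact Set.mem_singleton l
  have hl : l.Prime := G.sigma_prime l hlS
  -- the kernels `H_v` of the elementary abelian vertex quotients
  choose Hv hHv using hEX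
  have hn' : ∀ v, (Hv v).Normal := fun v => (hHv v).1.1
  have ho' : ∀ v, IsOpen (Hv v : Set P) := fun v => (hHv v).1.2.1
  have hE' : ∀ v, G.unrAbKer ≤ Hv v := fun v => (hHv v).1.2.2.1
  -- `Π_v ⊔ H_v = ⊤` and `H_v ≠ ⊤`
  have hsup : ∀ v, G.vertGp v ⊔ Hv v = ⊤ := by
    intro v
    haveI := hn' v
    refine top_le_iff.mp ?_
    have hWo : IsOpen ((G.vertGp v ⊔ Hv v : Subgroup P) : Set P) :=
      Subgroup.isOpen_mono le_sup_right (ho' v)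
    have hKv : G.vertexQuotientKer l v ≤ Hv v := (hHv v).2.2 ▸ inf_le_right
    have hA : G.unrVertAb ≤ G.vertGp v ⊔ Hv v :=
      G.unrVertAb_le_of_forall_vertGp_le hWo ((hE' v).trans le_sup_right) fun w => by
        by_cases hwv : w = v
        · subst hwv; exact le_sup_left
        · exact ((G.vertGp_le_vertexQuotientKer l hwv).trans hKv).trans le_sup_right
    rw [← (hHv v).2.1]
    exact sup_le hA le_sup_right
  have hne : ∀ v, Hv v ≠ ⊤ := by
    intro v h
    apply hNE v
    rw [← (hHv v).2.2, h, inf_top_eq]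
  -- the level `U := ⋂_v H_v`
  set U : Subgroup P := ⨅ v, Hv v with hU
  haveI hUn : U.Normal := Subgroup.normal_iInf_normal hn'
  have hUo : IsOpen (U : Set P) := by
    rw [hU, Subgroup.coe_iInf]
    exact isOpen_iInter_of_finite ho'
  haveI hUf : U.FiniteIndex := finiteIndex_of_isOpen U hUo
  have hKU : G.unrKer ≤ U := le_iInf fun v => G.unrKer_le_unrAbKer.trans (hE' v)
  -- counting: `2 · [Π : U Π_v] ≤ [Π : U]` for every vertex
  have hidx : ∀ v, 2 * (U ⊔ G.vertGp v).index ≤ U.index := by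
    intro v
    haveI := hn' v
    haveI : (Hv v).FiniteIndex := finiteIndex_of_isOpen _ (ho' v)
    have h1 : U.relIndex (U ⊔ G.vertGp v) * (U ⊔ G.vertGp v).index = U.index :=
      Subgroup.relIndex_mul_index le_sup_left
    have h2 : U.relIndex (U ⊔ G.vertGp v) = U.relIndex (G.vertGp v) :=
      Subgroup.relIndex_sup_left (G.vertGp v) U
    have h3 : (Hv v).relIndex (G.vertGp v) = (Hv v).index := by
      rw [← Subgroup.relIndex_top_right, ← hsup v, Subgroup.relIndex_sup_right]
    have h4 : (Hv v).relIndex (G.vertGp v) ∣ U.relIndex (G.vertGp v) :=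
      Subgroup.relIndex_dvd_of_le_left _ (iInf_le _ v)
    have h5 : U.relIndex (G.vertGp v) ≠ 0 := fun h0 =>
      hUf.index_ne_zero (Nat.eq_zero_of_zero_dvd (h0 ▸ Subgroup.relIndex_dvd_index_of_normal U _))
    have h6 : 2 ≤ U.relIndex (G.vertGp v) := by
      have hle := Nat.le_of_dvd (Nat.pos_of_ne_zero h5) h4
      rw [h3] at hle
      have hH2 : 2 ≤ (Hv v).index := Subgroup.one_lt_index_of_ne_top (hne v)
      exact hH2.trans hle
    rw [← h1, h2]
    exact Nat.mul_le_mul_right _ h6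
  -- hence `i(G_U) ≤ n(G_U)`
  have hi : G.graph.i ≤ G.graph.n + 1 := by
    have := hconn ⊤ (by rw [Subgroup.coe_top]; exact isOpen_univ)
    rwa [vertCount_top, nodeCount_top] at this
  have hn1 : 1 ≤ G.graph.n := Fintype.card_pos_iff.mpr hN
  have hcount : G.vertCount U ≤ G.nodeCount U := by
    rw [G.vertCount_eq_sum_index U, G.nodeCount_eq_of_isUnrCovering hKU]
    have hsum : 2 * ∑ v, (U ⊔ G.vertGp v).index ≤ G.graph.i * U.index := by
      rw [Finset.mul_sum]
      calc ∑ v, 2 * (U ⊔ G.vertGp v).index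
          ≤ ∑ _v : G.graph.V, U.index := Finset.sum_le_sum fun v _ => hidx v
        _ = G.graph.i * U.index := by rw [Finset.sum_const, Finset.card_univ, smul_eq_mul]; rfl
    have h2n : G.graph.i * U.index ≤ 2 * (G.graph.n * U.index) := by
      rw [← mul_assoc]
      exact Nat.mul_le_mul_right _ (by omega)
    exact Nat.le_of_mul_le_mul_left (hsum.trans h2n) two_pos
  have he : 0 < G.nodeCount U + 1 - G.vertCount U := by omega
  -- the two pro-`Σ` completions at the level `U`
  have hUc : IsClosed (U : Set P) := Subgroup.isClosed_of_isOpen U hUo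
  haveI : ((G.vertFil U).subgroupOf U).Normal :=
    normal_subgroupOf_of_commutator_le'' ((G.commutator_le_cuspFil U).trans (G.cuspFil_le_vertFil U))
  haveI : ((G.cuspFil U).subgroupOf (G.edgeFil U)).Normal :=
    normal_subgroupOf_of_commutator_le''
      ((Subgroup.commutator_mono (G.edgeFil_le hUc) (G.edgeFil_le hUc)).trans
        (G.commutator_le_cuspFil U))
  obtain ⟨ι, hι⟩ := hgrph U hUo
  obtain ⟨r, ι₁, ι₂, hι₁, hι₂⟩ := hdual hGs U hUo
  have hr : 0 < r := pos_of_completion_of_completion he hι hι₁ hl hlS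
  refine ⟨U, hUo, fun heq => ?_⟩
  refine false_of_forall_eq_one_of_completion hr hι₂ hl hlS fun x => ?_
  obtain ⟨e, rfl⟩ := QuotientGroup.mk_surjective x
  rw [QuotientGroup.eq_one_iff, Subgroup.mem_subgroupOf, ← heq]
  exact e.2

/-- **A noncuspidal sturdy `G` WITH A NODE has a `Π^unr`-level at which `M^edge ≠ M^cusp`**, over the
CORRECTED split injection `UnrVerticialSplitInjection'` (for the kernels: bodies (EX) and "[nontrivial!]"
of `PSCVertexQuotientPrimeProofs.lean`), `UnrVertAbOfRank`, `AbelianizedGrphRank`, `DualityRankEq`,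
`VertCountLeNodeCountSucc`. [cite: MochizukiCombGC2007, Rmk 1.3.1 p.10] -/
theorem exists_level_edgeFil_ne_cuspFil' {l : ℕ} (hS : G.Sigma = {l}) (hGs : G.IsSturdy)
    (hsplit : G.UnrVerticialSplitInjection') (hrank : G.UnrVertAbOfRank)
    (hgrph : G.AbelianizedGrphRank) (hdual : G.DualityRankEq) (hconn : G.VertCountLeNodeCountSucc)
    (hN : Nonempty G.graph.N) :
    ∃ U : Subgroup P, IsOpen (U : Set P) ∧ G.edgeFil U ≠ G.cuspFil U := by
  have hlS : l ∈ G.Sigma := by rw [hS]; exact Set.mem_singleton l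
  have hl : l.Prime := G.sigma_prime l hlS
  exact G.exists_level_edgeFil_ne_cuspFil_of_bodies hS hGs
    (fun v => G.exists_isElemAbUnrQuotient_inf_eq_vertexQuotientKer' hsplit hrank hGs hl hlS v)
    (fun v => G.vertexQuotientKer_ne_unrVertAb' hsplit hrank hGs hlS v) hgrph hdual hconn hN

end Level

/-! ### Nodes of `G` force nodes of `H`, over the corrected split injection -/

section Transfer

variable [CompactSpace P] [T2Space P]
variable {P' : Type u} [Group P'] [TopologicalSpace P'] [IsTopologicalGroup P']
variable (G : PSCDatum P) (H : PSCDatum P') (α : P ≃ₜ* P')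

/-- **Nodes of `G` force nodes of `H`** under an edge-wise filtration-preserving `α`, for noncuspidal
data with `G` sturdy and `Σ_G = {l}`, the split injection in its CORRECTED form
`UnrVerticialSplitInjection'`: at the level `U` of `exists_level_edgeFil_ne_cuspFil'`,
`M^edge_{G_U} ≠ M^cusp_{G_U}`, which `α` transports — impossible if `H` had neither nodes nor cusps.
[cite: MochizukiCombGC2007, Thm 1.6(ii) p.14] -/
theorem nonempty_nodes_of_isGraphicallyFiltrationPreserving' {l : ℕ} (hS : G.Sigma = {l})
    (hGs : G.IsSturdy) (hG0 : G.graph.IsNoncuspidal) (hH0 : H.graph.IsNoncuspidal)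
    (hsplit : G.UnrVerticialSplitInjection') (hrank : G.UnrVertAbOfRank)
    (hgrph : G.AbelianizedGrphRank) (hdual : G.DualityRankEq) (hconn : G.VertCountLeNodeCountSucc)
    (hα : G.IsEdgewiseFiltrationPreserving H α) (hN : Nonempty G.graph.N) :
    Nonempty H.graph.N := by
  by_contra hH
  haveI : IsEmpty H.graph.N := not_nonempty_iff.mp hH
  haveI := H.isEmpty_cusps_of_isNoncuspidal hH0
  haveI := G.isEmpty_cusps_of_isNoncuspidal hG0
  obtain ⟨U, hUo, hne⟩ := G.exists_level_edgeFil_ne_cuspFil' hS hGs hsplit hrank hgrph hdual hconn hN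
  apply hne
  apply Subgroup.map_injective (f := α.toMulEquiv.toMonoidHom) α.injective
  rw [hα U hUo, H.edgeFil_eq_of_isEmpty, G.cuspFil_eq_of_isEmpty, map_topologicalClosure α,
    Subgroup.map_commutator]

/-- **The displayed node-existence input `hn` of the cell's Rmk.-1.2.3-(v) kernel, DERIVED over the
CORRECTED split injection** for noncuspidal sturdy data with `Σ = {l}` on both sides and a graphically
filtration-preserving `α`, from the typed inputs for `G` and for `H` (`UnrVerticialSplitInjection'` in
place of the frozen F-1938 predicate). [cite: MochizukiCombGC2007, Thm 1.6(ii) p.14] -/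
theorem nonempty_nodes_iff_of_inputs' [CompactSpace P'] [T2Space P'] {l : ℕ} (hS : G.Sigma = {l})
    (hS' : H.Sigma = {l}) (hGs : G.IsSturdy) (hHs : H.IsSturdy) (hG0 : G.graph.IsNoncuspidal)
    (hH0 : H.graph.IsNoncuspidal)
    (hsplitG : G.UnrVerticialSplitInjection') (hrankG : G.UnrVertAbOfRank)
    (hgrphG : G.AbelianizedGrphRank) (hdualG : G.DualityRankEq) (hconnG : G.VertCountLeNodeCountSucc)
    (hsplitH : H.UnrVerticialSplitInjection') (hrankH : H.UnrVertAbOfRank)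
    (hgrphH : H.AbelianizedGrphRank) (hdualH : H.DualityRankEq) (hconnH : H.VertCountLeNodeCountSucc)
    (hα : G.IsGraphicallyFiltrationPreserving H α) :
    Nonempty G.graph.N ↔ Nonempty H.graph.N :=
  ⟨G.nonempty_nodes_of_isGraphicallyFiltrationPreserving' H α hS hGs hG0 hH0 hsplitG hrankG hgrphG
      hdualG hconnG hα.2,
    H.nonempty_nodes_of_isGraphicallyFiltrationPreserving' G α.symm hS' hHs hH0 hG0 hsplitH hrankH
      hgrphH hdualH hconnH hα.2.symm⟩

end Transfer

end PSCDatum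

end Literature.AnabelianGeometry.SemiGraphs

end
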